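import Mathlib.Analysis.Calculus.MeanValue
import Mathlib.Analysis.Normed.Ring.Units
import Mathlib.Topology.MetricSpace.Contracting
import HarnessLib

/-!
# The simplified Newton method: zeros near approximate zeros (Kantorovich-type existence theorem)

Topic `Literature/Analysis/Calculus`.  This file **proves** the contraction-mapping version of
Kantorovich's theorem on Newton's method, in the form printed as Proposition 6.7 of R. Magnus,
*Metric Spaces: A Companion to Analysis* (Springer SUMS, 2022), §6.6, pp. 210–212, together with
the remark made there (p. 212) that "the proof holds *totally without change* in the context that
`ℝⁿ` is replaced by a Banach space `E`":

> **Proposition 6.7.** Let `f : A → ℝⁿ` be differentiable, `A ⊆ ℝⁿ` open, with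
> `‖Df(x) − Df(y)‖ ≤ M |x − y|`. Let `a ∈ A`, `f(a) ≠ 0`, `Df(a)` invertible and
> `‖Df(a)⁻¹‖ |Df(a)⁻¹ f(a)| < 1/(4M)`. Let `R₋ = (1 − √(1 − 4M‖Df(a)⁻¹‖ |Df(a)⁻¹f(a)|)) / (2M‖Df(a)⁻¹‖)`,
> `R₊ = 1/(M‖Df(a)⁻¹‖)`. Then (1) if `B̄_{R₋}(a) ⊆ A` the equation `f(x) = 0` has a unique
> solution in `B̄_{R₋}(a)`; (2) if `R₋ < R < R₊` and `B̄_R(a) ⊆ A` that solution is the unique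
> solution in `B̄_R(a)`.

The printed proof applies Banach's fixed point theorem to the *simplified Newton map*
`g(x) = x − Df(a)⁻¹ f(x)` on `B̄_R(a)`, and what it establishes (p. 212, conditions (i), (ii)) is:
whenever `M R ‖Df(a)⁻¹‖ < 1` and `M R² ‖Df(a)⁻¹‖ + |Df(a)⁻¹ f(a)| ≤ R`, `g` is a strict
contraction of `B̄_R(a)` into itself, so `f` has exactly one zero in `B̄_R(a)`, the limit of the
simplified Newton iterates `x_{n+1} = x_n − Df(a)⁻¹ f(x_n)`, `x_0 = a`; `R₋` is the least such `R`.

## Contents (all proved)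

* `Literature.Analysis.Calculus.simplifiedNewtonMap A f` : the map `x ↦ x − A⁻¹ (f x)`.
* `Literature.Analysis.Calculus.existsUnique_zero_of_simplifiedNewton` : the statement
  established by the printed proof, for `f : E → F` between real normed spaces with `E` complete,
  under the hypotheses *on the closed ball* `B̄_R(a)` only: `f` has a Fréchet derivative `f' x` at
  every point of the ball, `f' a = A` is invertible (a continuous linear equivalence), the
  centred Lipschitz estimate `‖f' x − f' a‖ ≤ M ‖x − a‖` (all the printed proof uses of the
  Lipschitz condition), and (i), (ii).  Conclusion: a zero in the ball, unique there, to which the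
  simplified Newton iterates from `a` converge.
* `Literature.Analysis.Calculus.isInvertible_of_simplifiedNewton` : under (i), `f' x` is
  invertible at every point of the ball (Neumann series), so the zero found is *non-singular*.
* `Literature.Analysis.Calculus.exists_zero_near_of_simplifiedNewton` : the convenient
  sufficient condition `4 M ‖A⁻¹‖ ‖A⁻¹ f(a)‖ ≤ 1` (the printed premise, non-strict), with the
  radius `R = 2 ‖A⁻¹ f(a)‖` (note `R₋ ≤ 2‖A⁻¹f(a)‖ ≤ R₊/2`): an approximate zero `a` with small
  residual has a genuine non-singular zero within `2‖A⁻¹ f(a)‖`.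
* `Literature.Analysis.Calculus.MagnusSimplifiedNewton` (named fact, the `(i)/(ii)` statement) and
  its discharge `MagnusSimplifiedNewton_holds`.

This is the analytic input ("Newton approximation") of effective zero-finding arguments such as
Macintyre–Wilkie's decision procedure for the real exponential field (Macintyre–Wilkie 1996,
Thm. 4.1 there; Jones–Servi 2011, Lemma 3.5), which is why it is vendored here.

## What is NOT here

The exact radii `R₋`, `R₊` of the printed items (1)–(2) are not isolated as such (any `R`
satisfying (i)–(ii) is covered, `R₋` being the least of them); the genuine Newton–Kantorovich
theorem (Newton iteration with updated derivative, premise `< 1/(2M)`; Deuflhard, *Newton Methods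
for Nonlinear Problems* (2011), Thm. 2.1, and the sharp simplified-Newton Theorem 2.5 there) is
not treated.

## Mathlib search

Mathlib has the ingredients — the mean value inequality on convex sets
(`Convex.norm_image_sub_le_of_norm_hasFDerivWithin_le`), Banach's fixed point theorem on complete
subsets (`ContractingWith.exists_fixedPoint'`), the Neumann series (`Units.oneSub`) and
`ContinuousLinearMap.IsInvertible` — but no Newton/Kantorovich-type theorem
(`lean search 'Kantorovich|newton'` finds nothing relevant in Mathlib or `Literature`).

## References

* R. Magnus, *Metric Spaces: A Companion to Analysis*, Springer (2022), §6.6, Prop. 6.7,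
  pp. 210–212. [Magnus2022]
* P. Deuflhard, *Newton Methods for Nonlinear Problems*, Springer (2011), §2.1.2, Thm. 2.5.
* A. Macintyre, A. J. Wilkie, *On the decidability of the real exponential field*, in:
  Kreiseliana (1996), 441–467; G. O. Jones, T. Servi, *On the decidability of the real field with
  a generic power function*, J. Symb. Log. 76 (2011), Lemma 3.5.
-/

noncomputable section

open Metric Set Filter
open scoped Topology

namespace Literature.Analysis.Calculus

variable {E F : Type*} [NormedAddCommGroup E] [NormedSpace ℝ E]
  [NormedAddCommGroup F] [NormedSpace ℝ F]

/-- The **simplified Newton map** `g(x) = x − A⁻¹ f(x)` attached to `f : E → F` and an invertible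
`A : E ≃L F` (in applications `A = Df(a)`, the derivative frozen at the starting point); its fixed
points are exactly the zeros of `f`, and its iterates from `a` are the simplified Newton iterates
`x_{n+1} = x_n − Df(a)⁻¹ f(x_n)` (Magnus 2022, proof of Prop. 6.7, p. 211). [cite: Magnus2022, Prop. 6.7 (proof, p. 211)] -/
def simplifiedNewtonMap (A : E ≃L[ℝ] F) (f : E → F) (x : E) : E :=
  x - A.symm (f x)

/-- Unfolding lemma for `simplifiedNewtonMap`. [folklore] -/
theorem simplifiedNewtonMap_apply (A : E ≃L[ℝ] F) (f : E → F) (x : E) :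
    simplifiedNewtonMap A f x = x - A.symm (f x) :=
  rfl

/-- "It is clear that the problem `g(x) = x` is equivalent to `f(x) = 0`" (Magnus 2022, p. 211). [cite: Magnus2022, Prop. 6.7 (proof, p. 211)] -/
theorem simplifiedNewtonMap_eq_self_iff (A : E ≃L[ℝ] F) (f : E → F) (x : E) :
    simplifiedNewtonMap A f x = x ↔ f x = 0 := by
  rw [simplifiedNewtonMap_apply, sub_eq_self]
  constructor
  · intro h
    simpa using congrArg A h
  · intro h
    simp [h]

/-- The simplified Newton map has derivative `id − A⁻¹ ∘ f'(x) = A⁻¹ ∘ (f'(a) − f'(x))` wherever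
`f` has derivative `f'(x)`, when `A = f'(a)`. [folklore] -/
theorem hasFDerivAt_simplifiedNewtonMap {A : E ≃L[ℝ] F} {f : E → F} {f' : E → E →L[ℝ] F} {a x : E}
    (ha : f' a = (A : E →L[ℝ] F)) (hf : HasFDerivAt f (f' x) x) :
    HasFDerivAt (simplifiedNewtonMap A f) ((A.symm : F →L[ℝ] E).comp (f' a - f' x)) x := by
  have h : HasFDerivAt (simplifiedNewtonMap A f)
      (ContinuousLinearMap.id ℝ E - (A.symm : F →L[ℝ] E).comp (f' x)) x :=
    (hasFDerivAt_id x).sub ((A.symm : F →L[ℝ] E).hasFDerivAt.comp x hf)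
  convert h using 1
  ext v
  simp [ha]

section Main

variable [CompleteSpace E]

/-- **The simplified Newton method (Magnus 2022, Prop. 6.7, in the form its proof establishes;
Banach-space version).** Let `f : E → F` (`E` a real Banach space, `F` a real normed space) have a
Fréchet derivative `f' x` at every point of the closed ball `B̄_R(a)`, with `f' a = A` invertible
and `‖f' x − f' a‖ ≤ M ‖x − a‖` on the ball (`M ≥ 0`). If
(i) `M R ‖A⁻¹‖ < 1` and (ii) `M R² ‖A⁻¹‖ + ‖A⁻¹ f(a)‖ ≤ R`,
then `f` has a zero `x⋆ ∈ B̄_R(a)`, it is the only zero of `f` in `B̄_R(a)`, and the simplified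
Newton iterates `x_{n+1} = x_n − A⁻¹ f(x_n)`, `x₀ = a`, converge to `x⋆`.  (Printed for
`E = F = ℝⁿ` and a Lipschitz derivative on an open set `A ⊇ B̄_R(a)`; the proof, by Banach's fixed
point theorem for `g = id − A⁻¹ f` on `B̄_R(a)`, uses exactly the hypotheses stated here, and "holds
totally without change" in Banach spaces, p. 212.) [cite: Magnus2022, Prop. 6.7 (pp. 210–212, conditions (i), (ii) of the proof)] -/
theorem existsUnique_zero_of_simplifiedNewton {f : E → F} {f' : E → E →L[ℝ] F} {a : E}
    {A : E ≃L[ℝ] F} {M R : ℝ} (hR : 0 ≤ R) (hM₀ : 0 ≤ M)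
    (hf : ∀ x ∈ closedBall a R, HasFDerivAt f (f' x) x) (ha : f' a = (A : E →L[ℝ] F))
    (hM : ∀ x ∈ closedBall a R, ‖f' x - f' a‖ ≤ M * ‖x - a‖)
    (h₁ : M * R * ‖(A.symm : F →L[ℝ] E)‖ < 1)
    (h₂ : M * R ^ 2 * ‖(A.symm : F →L[ℝ] E)‖ + ‖A.symm (f a)‖ ≤ R) :
    ∃ x ∈ closedBall a R, f x = 0 ∧ (∀ y ∈ closedBall a R, f y = 0 → y = x) ∧
      Tendsto (fun n => (simplifiedNewtonMap A f)^[n] a) atTop (𝓝 x) := by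
  set β : ℝ := ‖(A.symm : F →L[ℝ] E)‖ with hβ
  set g : E → E := simplifiedNewtonMap A f with hg
  have hβ₀ : 0 ≤ β := norm_nonneg _
  -- the derivative of `g` on the ball is bounded by `β M R`
  have hg' : ∀ x ∈ closedBall a R, ‖(A.symm : F →L[ℝ] E).comp (f' a - f' x)‖ ≤ β * M * R := by
    intro x hx
    calc ‖(A.symm : F →L[ℝ] E).comp (f' a - f' x)‖ ≤ β * ‖f' a - f' x‖ :=
          ContinuousLinearMap.opNorm_comp_le _ _
      _ = β * ‖f' x - f' a‖ := by rw [norm_sub_rev]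
      _ ≤ β * (M * ‖x - a‖) := by gcongr; exact hM x hx
      _ ≤ β * (M * R) := by gcongr; exact mem_closedBall_iff_norm.1 hx
      _ = β * M * R := by ring
  -- hence `g` is `β M R`-Lipschitz on the ball (mean value inequality)
  have hlip : ∀ x ∈ closedBall a R, ∀ y ∈ closedBall a R, ‖g y - g x‖ ≤ β * M * R * ‖y - x‖ :=
    fun x hx y hy => (convex_closedBall a R).norm_image_sub_le_of_norm_hasFDerivWithin_le
      (fun z hz => (hasFDerivAt_simplifiedNewtonMap ha (hf z hz)).hasFDerivWithinAt) hg' hx hy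
  -- and `g` maps the ball into itself
  have hga : g a - a = -A.symm (f a) := by
    simp [hg, simplifiedNewtonMap_apply]
  have hmaps : MapsTo g (closedBall a R) (closedBall a R) := by
    intro x hx
    have hxa : ‖x - a‖ ≤ R := mem_closedBall_iff_norm.1 hx
    rw [mem_closedBall_iff_norm]
    calc ‖g x - a‖ = ‖(g x - g a) + (g a - a)‖ := by abel_nf
      _ ≤ ‖g x - g a‖ + ‖g a - a‖ := norm_add_le _ _
      _ ≤ β * M * R * ‖x - a‖ + ‖A.symm (f a)‖ := by
          gcongr
          · exact hlip a (mem_closedBall_self hR) x hx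
          · rw [hga, norm_neg]
      _ ≤ β * M * R * R + ‖A.symm (f a)‖ := by gcongr
      _ = M * R ^ 2 * β + ‖A.symm (f a)‖ := by ring
      _ ≤ R := h₂
  -- Banach's fixed point theorem on the complete subset `closedBall a R`
  have hK₀ : 0 ≤ β * M * R := by positivity
  obtain ⟨K, hK⟩ : ∃ K : NNReal, (K : ℝ) = β * M * R := ⟨⟨β * M * R, hK₀⟩, rfl⟩
  have hK₁ : K < 1 := by
    rw [← NNReal.coe_lt_coe, hK, NNReal.coe_one]
    calc β * M * R = M * R * β := by ring
      _ < 1 := h₁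
  have hlipK : LipschitzOnWith K g (closedBall a R) := by
    refine LipschitzOnWith.of_dist_le_mul fun x hx y hy => ?_
    rw [dist_eq_norm, dist_eq_norm, hK]
    exact hlip y hy x hx
  have hc : ContractingWith K (hmaps.restrict g _ _) := ⟨hK₁, hlipK.mapsToRestrict hmaps⟩
  obtain ⟨x, hx, hfix, htend, -⟩ :=
    hc.exists_fixedPoint' isClosed_closedBall.isComplete hmaps (mem_closedBall_self hR)
      (edist_ne_top _ _)
  have hfx : f x = 0 := (simplifiedNewtonMap_eq_self_iff A f x).1 hfix
  refine ⟨x, hx, hfx, fun y hy hfy => ?_, htend⟩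
  -- uniqueness: two fixed points of a strict contraction coincide
  have hgy : g y = y := (simplifiedNewtonMap_eq_self_iff A f y).2 hfy
  have hle : ‖y - x‖ ≤ β * M * R * ‖y - x‖ := by
    have := hlip x hx y hy
    rwa [hgy, show g x = x from hfix] at this
  have hlt : β * M * R < 1 := by
    calc β * M * R = M * R * β := by ring
      _ < 1 := h₁
  have h0 : ‖y - x‖ = 0 := by
    nlinarith [norm_nonneg (y - x)]
  exact sub_eq_zero.1 (norm_eq_zero.1 h0)

end Main

/-- **Non-singularity along the ball** (the remark behind item (2) of Magnus 2022, Prop. 6.7, and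
the `V^{reg}` in Macintyre–Wilkie's use): if `f' a = A` is invertible and
`‖f' x − f' a‖ ≤ M‖x − a‖` with `M ‖x − a‖ ‖A⁻¹‖ < 1`, then `f' x` is invertible — indeed
`f' x = A ∘ (1 + A⁻¹(f' x − f' a))` with `‖A⁻¹(f' x − f' a)‖ < 1` (Neumann series,
`Units.oneSub`). [folklore] -/
theorem isInvertible_of_norm_sub_le [CompleteSpace E] {f' : E → E →L[ℝ] F} {a x : E}
    {A : E ≃L[ℝ] F} {M : ℝ} (ha : f' a = (A : E →L[ℝ] F)) (hM : ‖f' x - f' a‖ ≤ M * ‖x - a‖)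
    (h₁ : M * ‖x - a‖ * ‖(A.symm : F →L[ℝ] E)‖ < 1) : (f' x).IsInvertible := by
  set T : E →L[ℝ] E := (A.symm : F →L[ℝ] E).comp (f' x - f' a) with hT
  have hTn : ‖T‖ < 1 := by
    calc ‖T‖ ≤ ‖(A.symm : F →L[ℝ] E)‖ * ‖f' x - f' a‖ := ContinuousLinearMap.opNorm_comp_le _ _
      _ ≤ ‖(A.symm : F →L[ℝ] E)‖ * (M * ‖x - a‖) := by gcongr
      _ = M * ‖x - a‖ * ‖(A.symm : F →L[ℝ] E)‖ := by ring
      _ < 1 := h₁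
  have hTn' : ‖-T‖ < 1 := by rwa [norm_neg]
  set u : (E →L[ℝ] E)ˣ := Units.oneSub (-T) hTn' with hu
  refine ⟨(ContinuousLinearEquiv.unitsEquiv ℝ E u).trans A, ?_⟩
  ext v
  have huv : (u : E →L[ℝ] E) v = v + T v := by
    simp [hu, Units.oneSub]
  simp [ContinuousLinearEquiv.trans_apply, huv, hT, ha]

/-- **Non-singularity of the derivative on the whole ball** under hypothesis (i) of
`existsUnique_zero_of_simplifiedNewton`: for `x ∈ B̄_R(a)`, `M R ‖A⁻¹‖ < 1` gives
`M ‖x − a‖ ‖A⁻¹‖ < 1`. In particular the zero produced there is a non-singular zero. [folklore] -/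
theorem isInvertible_of_simplifiedNewton [CompleteSpace E] {f' : E → E →L[ℝ] F} {a x : E}
    {A : E ≃L[ℝ] F} {M R : ℝ} (hM₀ : 0 ≤ M) (ha : f' a = (A : E →L[ℝ] F))
    (hM : ‖f' x - f' a‖ ≤ M * ‖x - a‖) (hx : x ∈ closedBall a R)
    (h₁ : M * R * ‖(A.symm : F →L[ℝ] E)‖ < 1) : (f' x).IsInvertible := by
  refine isInvertible_of_norm_sub_le ha hM (lt_of_le_of_lt ?_ h₁)
  have hxa : ‖x - a‖ ≤ R := mem_closedBall_iff_norm.1 hx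
  have hβ₀ : 0 ≤ ‖(A.symm : F →L[ℝ] E)‖ := norm_nonneg _
  gcongr

/-- **Zeros near approximate zeros (Magnus 2022, Prop. 6.7, item (1), with the radius `2‖A⁻¹f(a)‖`
in place of the optimal `R₋ ≤ 2‖A⁻¹f(a)‖`).** If `f` has derivative `f' x` on
`B̄ = B̄_{2η}(a)`, `η = ‖A⁻¹ f(a)‖`, `f' a = A` invertible, `‖f' x − f' a‖ ≤ M‖x − a‖` on `B̄`
(`M ≥ 0`), and the Kantorovich-type smallness condition `4 M ‖A⁻¹‖ ‖A⁻¹ f(a)‖ ≤ 1` holds, then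
`f` has a zero `x⋆` with `‖x⋆ − a‖ ≤ 2‖A⁻¹ f(a)‖`, unique in that ball, at which `f' x⋆` is
invertible, and the simplified Newton iterates from `a` converge to it. (Conditions (i), (ii) hold
with `R = 2η`: `2Mη‖A⁻¹‖ ≤ 1/2 < 1` and `4Mη²‖A⁻¹‖ + η ≤ 2η`.) [cite: Magnus2022, Prop. 6.7 (1)] -/
theorem exists_zero_near_of_simplifiedNewton [CompleteSpace E] {f : E → F} {f' : E → E →L[ℝ] F}
    {a : E} {A : E ≃L[ℝ] F} {M : ℝ} (hM₀ : 0 ≤ M)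
    (hf : ∀ x ∈ closedBall a (2 * ‖A.symm (f a)‖), HasFDerivAt f (f' x) x)
    (ha : f' a = (A : E →L[ℝ] F))
    (hM : ∀ x ∈ closedBall a (2 * ‖A.symm (f a)‖), ‖f' x - f' a‖ ≤ M * ‖x - a‖)
    (h : 4 * M * ‖(A.symm : F →L[ℝ] E)‖ * ‖A.symm (f a)‖ ≤ 1) :
    ∃ x ∈ closedBall a (2 * ‖A.symm (f a)‖), f x = 0 ∧ (f' x).IsInvertible ∧
      (∀ y ∈ closedBall a (2 * ‖A.symm (f a)‖), f y = 0 → y = x) ∧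
      Tendsto (fun n => (simplifiedNewtonMap A f)^[n] a) atTop (𝓝 x) := by
  set η : ℝ := ‖A.symm (f a)‖ with hη
  set β : ℝ := ‖(A.symm : F →L[ℝ] E)‖ with hβ
  have hη₀ : 0 ≤ η := norm_nonneg _
  have hβ₀ : 0 ≤ β := norm_nonneg _
  have hR : 0 ≤ 2 * η := by positivity
  have h₁ : M * (2 * η) * β < 1 := by
    nlinarith
  have h₂ : M * (2 * η) ^ 2 * β + ‖A.symm (f a)‖ ≤ 2 * η := by
    rw [← hη]
    nlinarith
  obtain ⟨x, hx, hfx, huniq, htend⟩ :=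
    existsUnique_zero_of_simplifiedNewton hR hM₀ hf ha hM h₁ h₂
  exact ⟨x, hx, hfx, isInvertible_of_simplifiedNewton hM₀ ha (hM x hx) hx h₁, huniq, htend⟩

/-! ### Named-fact packaging -/

/-- **Magnus 2022, Prop. 6.7 (simplified Newton method), as a named fact**: the statement of
`existsUnique_zero_of_simplifiedNewton` — for `f : E → F` (`E` real Banach, `F` real normed) with
derivative `f'` on `B̄_R(a)`, `f' a = A` invertible, `‖f' x − f' a‖ ≤ M‖x − a‖` on the ball,
(i) `M R ‖A⁻¹‖ < 1`, (ii) `M R² ‖A⁻¹‖ + ‖A⁻¹ f(a)‖ ≤ R`: a zero in `B̄_R(a)`, unique there, limit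
of the simplified Newton iterates. Discharged below (`MagnusSimplifiedNewton_holds`). [cite: Magnus2022, Prop. 6.7] -/
def MagnusSimplifiedNewton : Prop :=
  ∀ {E F : Type*} [NormedAddCommGroup E] [NormedSpace ℝ E] [CompleteSpace E]
    [NormedAddCommGroup F] [NormedSpace ℝ F] {f : E → F} {f' : E → E →L[ℝ] F} {a : E}
    {A : E ≃L[ℝ] F} {M R : ℝ}, 0 ≤ R → 0 ≤ M →
    (∀ x ∈ closedBall a R, HasFDerivAt f (f' x) x) → f' a = (A : E →L[ℝ] F) →
    (∀ x ∈ closedBall a R, ‖f' x - f' a‖ ≤ M * ‖x - a‖) →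
    M * R * ‖(A.symm : F →L[ℝ] E)‖ < 1 →
    M * R ^ 2 * ‖(A.symm : F →L[ℝ] E)‖ + ‖A.symm (f a)‖ ≤ R →
    ∃ x ∈ closedBall a R, f x = 0 ∧ (∀ y ∈ closedBall a R, f y = 0 → y = x) ∧
      Tendsto (fun n => (simplifiedNewtonMap A f)^[n] a) atTop (𝓝 x)

/-- Discharge of the named fact `MagnusSimplifiedNewton` (by `existsUnique_zero_of_simplifiedNewton`). [cite: Magnus2022, Prop. 6.7] -/
theorem MagnusSimplifiedNewton_holds : MagnusSimplifiedNewton :=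
  fun hR hM₀ hf ha hM h₁ h₂ => existsUnique_zero_of_simplifiedNewton hR hM₀ hf ha hM h₁ h₂

end Literature.Analysis.Calculus

end
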